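import Summits.QuantumFields.YangMills.Cruxes.RunningReduction.Lines.birth

noncomputable section
/-!
# Lines/kt_handover_tower — the DYADIC TOWER ∕ FILL split of stub 3a′ `CoarseHandoverUpper 2` of the line of record «KTR» (supersedes «KTH» ∕ «KT») on crux RED = `RunningReduction`
(item stmt-QuantumFields-19978, route LuscherReduction; crux idea card `Ideas/handover-split.md` rev 4, §«REV 4 (g4)»; owner line `Lines-KTR.lean` rev 2 2026-08-27T02:12Z registers
`stub_coarseHandoverUpper2 : CoarseHandoverUpper 2` (XL) and `stub_coarseNoIntruderAt2 : CoarseNoIntruderAt 2` (L) from `Lines/kt_coarse_handover.lean` = its part 1; see also `OWNER-MEMO-3a-g16.md`).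
Author: planner ym-cruxidea-19978-2 (crux-ideate round 1, g4), 2026-08-27.  SORRY-FREE; NOT a registered skeleton — typed raw material + proved seams for the
coming crux-plan seat on 3a′.  HONEST FRAMING: femto rung R2b1 only; nothing here touches the summit.

REV 2 (g8, 2026-08-27, same author; rev 1 = commit 205dcbd713a6, sha16 8d15b573281db393): answers OWNER RULING (r2) (p1 g18, STATUS 2026-08-27T05:16:38Z:
«dyadic proofs `L = L0·2^j` acceptable LINE-internally; the crux text stays `∀ L ≥ L0`; the densification is a separate S/M seam to be typed when such a proof
exists») by TYPING THAT SEAM NOW and locating it — new § «MIXED-BLOCK FILL» at the end: `blockLen` tiling arithmetic, `BoundedRatioStepUpper` (STEP over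
UNEQUAL near-cubic boxes, size ratio `L/N ∈ [2,4]`), `BoundedRatioFill L0` (the seam), and the proved glue `coarseHandoverUpper_of_boundedRatioStep :
BoundedRatioStepUpper → CoarseHandoverUpper L0` (3a′ for ALL `L`, every coarse size, from ONE one-step statement) + calibration.  It CORRECTS rev 1's claim
(F17 bullet and the `IncommensurableFill` docstring below, kept verbatim for the record) that «no blocking map relates incommensurable cutoffs, so FILL needs
lever (d)'s continuum objects»: that is true for EQUAL cubic blocks only — `ℤ/L` is tiled by `N` intervals of lengths `⌊L/N⌋, ⌈L/N⌉` for every `N ≤ L/2`,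
so ONE Bałaban-type averaging step over boxes with sides in `{q, q+1}` (≤ 8 shapes) maps `(ℤ/L)³` onto a DYADIC `(ℤ/N)³`, `2N ≤ L ≤ 4N`, after which the
tower is dyadic.  Verdict on (r2): stand-alone (no RG step) the seam is lattice universality of 3a′'s own class (XL, not S/M); inside an RG line it is free
PROVIDED the one-step estimate is typed for bounded-ratio boxes rather than for cubes of side 2 — then no separate seam and no continuum detour exist.

## Why this file exists (findings F17–F19 of the card)
* F17 DIVISIBILITY.  3a′ (like RED, KT's stub 3 and `FemtoGapOfRecord`) quantifies over ALL fine sizes `L ≥ L1`, but a renormalisation-group proof of 3a′ by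
  block-spin ∕ decimation steps `N ↦ N/2` at matched two-loop label reaches the coarse partner `L0 = 2` only from `L ∈ 2·2^ℕ`; a prime `L` admits no blocking at all
  except the total one `L ↦ 1`, which is the one-site comparison RED itself (costume).  Hence an RG line for 3a′ splits canonically into
  TOWER = `CoarseHandoverUpperDyadic 2` (3a′ restricted to `L = 2^{j+1}`) and FILL = `IncommensurableFill 2` (every fine window point hands over, upper direction,
  slack `e^{ελ/2}`, to SOME dyadic lattice of comparable size at matched label) — `coarseHandoverUpper_of_dyadic_fill` below, proved.  FILL is irreducible
  «incommensurable-cutoff universality»: it is exactly what lever (d) (continuum detour) must supply and what no blocking map supplies.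
  [REV 2 CORRECTION: false for UNEQUAL boxes — see § MIXED-BLOCK FILL: `BoundedRatioFill`, `coarseHandoverUpper_of_boundedRatioStep`.]
* F17b SCHEDULE.  The one-step statement must carry a budget SUMMABLE over the tower yet DOMINATING the genuine per-step mismatch of matched two-loop labels
  (three-loop running: rate mismatch `≈ 4·10⁻³ q₁Δ_k λ⁴/β_M²`, `β_M ≈ 2λ⁻³ + 4b₀ log M`) and the lattice artefacts `O(λ²/M²)`: `DyadicStepUpper` uses
  `C λ² /(⌊log₂ M⌋+1)²` (summable: `Σ 1/(i+1)² < 2`; dominating: `(log₂M+1)⁻² ≫ β_M⁻²λ³` in the window).  A budget `e^{±Cλ²/M²}` per step (tree `Birth.FemtoStep`,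
  def-only) is summable but is NOT expected to dominate the three-loop mismatch for `M ≳ 10³Cλ⁻⁸/(|q₁|Δ_k)` — do not register that shape.
  `coarseHandoverUpperDyadic_of_step : MatchedCouplingUniform → DyadicStepUpper → CoarseHandoverUpperDyadic L0` telescopes it (proved, `Nat.le_induction`,
  partial sums `2 − 1/j`), and `matchedCouplingUniform` (proved, `lamM = 1/2` for ALL coarse sizes) supplies the intermediate matched couplings.
* F18 (dead) consecutive-size fill-in `L ↦ L−1` would need precision `λ²/L²` per step, finer than anything in KT currency.  F19 = the STEP's proof obligations
  (one-step Bałaban-type effective action in CORRELATION form — block-observable correlations are exactly preserved by the pushforward, reflection positivity ∕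
  the transfer structure are not; one-scale visibility of the fine low-lying states; rigorous two-loop matching with `O(β⁻²)` remainder; artefacts `O(λ²/M²)`).

## What is here (all over tree declarations; every `theorem` proved)
`MatchedCouplingUniform` + `matchedCouplingUniform`; `DyadicStepUpper`; `CoarseHandoverUpperDyadic L0`; `IncommensurableFill L0`; `KTCoarseNoIntruderDyadic L0`
(KT's stub-3 text on the dyadic sizes only = what TOWER ∧ 3b′ give WITHOUT FILL: `ktCoarseNoIntruderDyadic_of_handover`); `DyadicLowerLaw L0` (calibration only);
seams `coarseHandoverUpperDyadic_of_step`, `coarseHandoverUpperDyadic_of_upper` (TOWER ⟸ 3a′), `coarseHandoverUpper_of_dyadic_fill` (3a′ ⟸ TOWER ∧ FILL),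
`ktCoarseNoIntruderDyadic_of_handover`, `incommensurableFill_of_noIntruder` (FILL ⟸ KT stub 3 ∧ `DyadicLowerLaw L0`: FILL is not stronger than what the route believes).
REV 2 adds: `blockLen` + `sum_blockLen_range` ∕ `le_blockLen` ∕ `blockLen_le` ∕ `exists_dyadic_partner` (tiling arithmetic; general base: `exists_sadic_partner`,
`blockLen_mem_window_base`); `BoundedRatioStepUpper`,
`dyadicStepUpper_of_boundedRatio`; `BoundedRatioFill L0`, `boundedRatioFill_of_step`, `coarseHandoverUpper_of_dyadic_bfill`, `coarseHandoverUpper_of_boundedRatioStep`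
(3a′ ∀ `L` ⟸ ONE stub), `boundedRatioFill_of_noIntruder` (calibration).
NEEDS-OWNER (asked, not decided here) [ANSWERED by owner ruling (r2) 2026-08-27T05:16:38Z: YES line-internally, crux text stays ∀ L — whence REV 2]: is a DYADIC leaf (`L ∈ 2^ℕ·L0`, i.e. `KTCoarseNoIntruderDyadic 2` in place of stub 3) acceptable as the rung of record for an
RG line?  If yes, FILL disappears from that line; if no, FILL (or a divisibility-free proof of 3a′: momentum-slice phase-cell expansion in the femto box) is load-bearing.
-/

namespace Summit.QuantumFields.YangMills.Cruxes.RunningReduction.KTHandoverTower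

open MeasureTheory Filter Topology Real
open Literature.MathematicalPhysics.QuantumFieldTheory
open Literature.MathematicalPhysics.QuantumLattice
open Literature.Analysis.OperatorTheory.YMMatrixModel
open Summit.QuantumFields.YangMills.Theorems.FemtoTransferGap

/-! ## §0 COMPAT COPIES (tree form only). `Cruxes/**` workfiles become importable modules only at farm rebuilds (`Lines/kt_coarse_handover.lean`, rev 3,
had no olean 2 h after its commit), so this module is SELF-CONTAINED over `Lines/birth.lean`: the seven rev-3 declarations it needs are re-declared here with
CHARACTER-IDENTICAL bodies under THIS namespace — definitionally equal to `…KTCoarseHandover.CoarseHandoverUpper` / `CoarseNoIntruderAt` / `KTCoarseNoIntruder`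
(tree module rev 3 = KTR part 1), so every theorem below re-targets to KTR's registered stubs by `Iff.rfl` / `exact`.  PASTE FORM (for a file that already contains
KTR part 1): drop §0 and add `open Summit.QuantumFields.YangMills.Cruxes.RunningReduction.KTCoarseHandover` (HOME `tower_body.lean` is exactly that; checked
against the verbatim part 1 as `bc/tower_selfcontained.lean`, rc 0). -/

/-- COMPAT COPY (verbatim) of `KTCoarseHandover.KTCoarseNoIntruder` = KT's stub-3 text `KT.CoarseNoIntruder`. -/
def KTCoarseNoIntruder : Prop :=
  ∀ k : ℕ, ∀ d : ℝ, d < levelGap k → ∃ lam0 : ℝ, 0 < lam0 ∧ ∀ lam : ℝ, 0 < lam → lam ≤ lam0 →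
    ∃ L0 : ℕ, ∀ (L : ℕ) [NeZero L], L0 ≤ L → ∀ β : ℝ, InFemtoWindow lam β L →
      levelValue su2Rep L β k ≤ Real.exp (-(d * luscherLambda β L) / L) * levelValue su2Rep L β 0

/-- COMPAT COPY (verbatim) of `KTCoarseHandover.CoarseHandoverUpper` = 3a′ (KTR `Stmt.stub_coarseHandoverUpper2` at `L0 = 2`). -/
def CoarseHandoverUpper (L0 : ℕ) [NeZero L0] : Prop :=
  ∀ k : ℕ, ∀ ε : ℝ, 0 < ε → ∃ lam0 : ℝ, 0 < lam0 ∧ ∀ lam : ℝ, 0 < lam → lam ≤ lam0 →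
    ∃ L1 : ℕ, ∀ (L : ℕ) [NeZero L], L1 ≤ L → ∀ β : ℝ, InFemtoWindow lam β L →
      ∀ β' : ℝ, 1 ≤ β' → luscherLambda β' L0 = luscherLambda β L →
        levelValue su2Rep L β k ^ L * levelValue su2Rep L0 β' 0 ^ L0 ≤
          Real.exp (ε * luscherLambda β L) * (levelValue su2Rep L0 β' k ^ L0 * levelValue su2Rep L β 0 ^ L)

/-- COMPAT COPY (verbatim) of `KTCoarseHandover.CoarseNoIntruderAt` = 3b′ (KTR `Stmt.stub_coarseNoIntruderAt2` at `L0 = 2`). -/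
def CoarseNoIntruderAt (L0 : ℕ) [NeZero L0] : Prop :=
  ∀ k : ℕ, ∀ d : ℝ, d < levelGap k → ∃ lam0 : ℝ, 0 < lam0 ∧ ∀ lam : ℝ, 0 < lam → lam ≤ lam0 →
    ∀ β : ℝ, InFemtoWindow lam β L0 →
      levelValue su2Rep L0 β k ≤ Real.exp (-(d * luscherLambda β L0) / L0) * levelValue su2Rep L0 β 0

-- COMPAT COPIES (verbatim) of the rev-3 helpers `b0_pos`, `b1_pos`, `b1_div_two_b0_sq`, `invRunningCoupling_ge`.
theorem b0_pos : 0 < b0 := by unfold b0; positivity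
theorem b1_pos : 0 < b1 := by unfold b1; positivity

/-- `b₁/(2b₀²) = 51/121` (the docstring of `b1`). -/
theorem b1_div_two_b0_sq : b1 / (2 * b0 ^ 2) = 51 / 121 := by
  unfold b0 b1
  have hπ : (π : ℝ) ≠ 0 := Real.pi_ne_zero
  field_simp
  ring

/-- Linear lower bound `1/ḡ²(β, L0) ≥ (19/242)·β − 2b₀·log L0` for `β > 0` (from `log x ≤ x − 1`). -/
theorem invRunningCoupling_ge {β : ℝ} (hβ : 0 < β) (L0 : ℕ) :
    19 / 242 * β - 2 * b0 * Real.log (L0 : ℝ) ≤ invRunningCoupling β L0 := by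
  have hb0 := b0_pos
  have hb1 := b1_pos
  have hb0ne : b0 ≠ 0 := hb0.ne'
  set t := Real.log (2 * b0 / β) with ht
  have hlog : 1 - β / (2 * b0) ≤ t := by
    have hx : 0 < β / (2 * b0) := div_pos hβ (mul_pos two_pos hb0)
    have h1 := Real.log_le_sub_one_of_pos hx
    have h2 : Real.log (2 * b0 / β) = -Real.log (β / (2 * b0)) := by
      rw [← Real.log_inv, inv_div]
    rw [ht, h2]; linarith
  have hid : invRunningCoupling β L0 = -2 * b0 * Real.log (L0 : ℝ) + β / 2 + (b1 / b0) * t := by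
    unfold invRunningCoupling sizeLog; rw [← ht]; field_simp; ring
  have hc : (b1 / b0) * (1 - β / (2 * b0)) ≤ (b1 / b0) * t := mul_le_mul_of_nonneg_left hlog (div_pos hb1 hb0).le
  have hc2 : (b1 / b0) * (1 - β / (2 * b0)) = b1 / b0 - (b1 / (2 * b0 ^ 2)) * β := by field_simp
  rw [hc2, b1_div_two_b0_sq] at hc
  have hpos : 0 < b1 / b0 := div_pos hb1 hb0
  rw [hid]
  linarith


/-! ## Uniform matching of two-loop labels (support, PROVED): one `lamM` for every coarse size -/

/-- **`MatchedCouplingUniform` (support, S)**: there is ONE `lamM > 0` such that for EVERY coarse size `L0 ≥ 1`, every `lam ≤ lamM` and every fine window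
point `(L, β)` a coarse partner `β' ≥ 1` with `λ(β', L0) = λ(β, L)` exists.  (Tree-module `MatchedCoupling L0` has `lamM` depending on `L0`; the tower needs
the intermediate partners at `M = L0·2^i → ∞`, hence uniformity.) -/
def MatchedCouplingUniform : Prop :=
  ∃ lamM : ℝ, 0 < lamM ∧ ∀ (L0 : ℕ) [NeZero L0] (lam : ℝ), 0 < lam → lam ≤ lamM →
    ∀ (L : ℕ) [NeZero L] (β : ℝ), InFemtoWindow lam β L → ∃ β' : ℝ, 1 ≤ β' ∧ luscherLambda β' L0 = luscherLambda β L

/-- `2b₀ = 11/(12π²) < 1`. -/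
theorem two_b0_lt_one : 2 * b0 < 1 := by
  unfold b0
  have hπ : (3 : ℝ) < π := Real.pi_gt_three
  rw [show (2 : ℝ) * (11 / (24 * π ^ 2)) = 11 / (12 * π ^ 2) by ring, div_lt_one (by positivity)]
  nlinarith

/-- `1/ḡ²(β = 1, L0) ≤ 1/2` for every `L0 ≥ 1`: at `β = 1` the two-loop label is `≥ 2^{1/3} > 1`, whatever the coarse size. -/
theorem invRunningCoupling_one_le (L0 : ℕ) [NeZero L0] : invRunningCoupling 1 L0 ≤ 1 / 2 := by
  have hb0 := b0_pos
  have hb1 := b1_pos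
  have hb0ne : b0 ≠ 0 := hb0.ne'
  have hlogL : 0 ≤ Real.log (L0 : ℝ) := Real.log_nonneg (by exact_mod_cast NeZero.one_le)
  have hlog : Real.log (2 * b0) < 0 := Real.log_neg (by positivity) two_b0_lt_one
  have hid : invRunningCoupling 1 L0 = -2 * b0 * Real.log (L0 : ℝ) + 1 / 2 + (b1 / b0) * Real.log (2 * b0) := by
    unfold invRunningCoupling sizeLog
    rw [div_one]
    field_simp
    ring
  rw [hid]
  have h1 : 0 ≤ b0 * Real.log (L0 : ℝ) := mul_nonneg hb0.le hlogL
  have h2 : (b1 / b0) * Real.log (2 * b0) ≤ 0 :=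
    mul_nonpos_iff.mpr (Or.inl ⟨(div_pos hb1 hb0).le, hlog.le⟩)
  linarith

/-- **`MatchedCouplingUniform` HOLDS (proved)**, with `lamM = 1/2`: in the window `v = λ(β,L) ≤ 2lam ≤ 1`, so the target value `y = v⁻³ ≥ 1` of
`β' ↦ 1/ḡ²(β',L0)` lies between `1/ḡ²(1,L0) ≤ 1/2` and `1/ḡ²(β₂,L0) ≥ y + 1`, `β₂ = (242/19)(y + 2b₀ log L0 + 1)` (linear lower bound
`invRunningCoupling_ge`); intermediate value theorem on `[1, β₂]`. -/
theorem matchedCouplingUniform : MatchedCouplingUniform := by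
  refine ⟨1 / 2, by norm_num, ?_⟩
  intro L0 _ lam hlam hle L _ β hw
  have hb0 := b0_pos
  have hlogL : 0 ≤ Real.log (L0 : ℝ) := Real.log_nonneg (by exact_mod_cast NeZero.one_le)
  have hbl : 0 ≤ 2 * b0 * Real.log (L0 : ℝ) := mul_nonneg (mul_nonneg two_pos.le hb0.le) hlogL
  set f : ℝ → ℝ := fun β => invRunningCoupling β L0 with hf
  set v : ℝ := luscherLambda β L with hv
  have hvpos : 0 < v := luscherLambda_pos_of_window hlam hw
  have hvle : v ≤ 1 := by have := hw.2.2; linarith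
  set y : ℝ := (v ^ 3)⁻¹ with hy
  have hypos : 0 < y := by positivity
  have hy1 : 1 ≤ y := by
    rw [hy, le_inv_comm₀ one_pos (by positivity), inv_one]
    exact pow_le_one₀ hvpos.le hvle
  -- lower point `β = 1`
  have hf1 : f 1 ≤ y := by
    show invRunningCoupling 1 L0 ≤ y
    linarith [invRunningCoupling_one_le L0]
  -- upper point
  set β₂ : ℝ := 242 / 19 * (y + 2 * b0 * Real.log (L0 : ℝ) + 1) with hβ₂
  have h12 : (1 : ℝ) ≤ β₂ := by rw [hβ₂]; nlinarith [hypos, hbl]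
  have hf₂ : y ≤ f β₂ := by
    have h1 := invRunningCoupling_ge (lt_of_lt_of_le one_pos h12) L0
    have h2 : 19 / 242 * β₂ - 2 * b0 * Real.log (L0 : ℝ) = y + 1 := by rw [hβ₂]; ring
    show y ≤ invRunningCoupling β₂ L0
    linarith
  -- continuity of `f` on `[1, β₂]`
  have hne : ∀ x ∈ Set.Icc (1 : ℝ) β₂, x ≠ 0 := fun x hx => (lt_of_lt_of_le one_pos hx.1).ne'
  have hcont : ContinuousOn f (Set.Icc 1 β₂) := by
    show ContinuousOn (fun β : ℝ => invRunningCoupling β L0) (Set.Icc 1 β₂)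
    unfold invRunningCoupling sizeLog
    apply ContinuousOn.mul continuousOn_const
    apply ContinuousOn.sub
    · exact ContinuousOn.sub continuousOn_const (continuousOn_id.div_const _)
    · apply ContinuousOn.mul continuousOn_const
      apply ContinuousOn.log
      · exact continuousOn_const.div continuousOn_id hne
      · intro x hx; exact div_ne_zero (mul_pos two_pos hb0).ne' (hne x hx)
  -- IVT
  obtain ⟨β', hβ'mem, hβ'eq⟩ := intermediate_value_Icc h12 hcont ⟨hf1, hf₂⟩
  refine ⟨β', hβ'mem.1, ?_⟩
  have hfβ' : invRunningCoupling β' L0 = y := hβ'eq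
  show (max (invRunningCoupling β' L0) 0) ^ (-(1 : ℝ) / 3) = v
  rw [hfβ', max_eq_left hypos.le, hy]
  have hexp : (-(1 : ℝ) / 3) = -(((3 : ℕ) : ℝ)⁻¹) := by norm_num
  rw [hexp, Real.rpow_neg (by positivity), Real.inv_rpow (by positivity), inv_inv,
    Real.pow_rpow_inv_natCast hvpos.le (by norm_num)]


/-! ## The one-step statement with a summable-and-dominating schedule, the dyadic tower, and the telescoping (PROVED) -/

/-- **STEP = `DyadicStepUpper` (XL; the candidate load-bearing stub of an RG line for 3a′)**: ONE dyadic coarse-graining `N = 2M ↦ M` at matched two-loop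
label, no-intruder direction only, cross-multiplied, with the budget `exp(C·λ²/(⌊log₂M⌋+1)²)` — uniform in `M ≥ 1` (at `M = 1, 2` it is a fixed-lattice
statement of `FixedLatticeReduction` size; as `M → ∞` the schedule decays like `1/log²M`, which still dominates the three-loop label mismatch `∝ λ⁴/β_M²` and
the artefacts `λ²/M²`).  Proof obligations (F19): one-step effective action in correlation form, one-scale visibility of the fine low states, two-loop matching. -/
def DyadicStepUpper : Prop :=
  ∀ k : ℕ, ∃ C lam0 : ℝ, 0 < lam0 ∧ ∀ lam : ℝ, 0 < lam → lam ≤ lam0 →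
    ∀ (M N : ℕ) [NeZero M] [NeZero N], N = 2 * M → ∀ β β' : ℝ, InFemtoWindow lam β N → 1 ≤ β' →
      luscherLambda β' M = luscherLambda β N →
        levelValue su2Rep N β k ^ N * levelValue su2Rep M β' 0 ^ M ≤
          Real.exp (C * luscherLambda β N ^ 2 / ((Nat.log 2 M : ℝ) + 1) ^ 2) *
            (levelValue su2Rep M β' k ^ M * levelValue su2Rep N β 0 ^ N)

/-- **TOWER = `CoarseHandoverUpperDyadic L0`**: 3a′ `CoarseHandoverUpper L0` restricted to the dyadic fine sizes `L = L0·2^j`, `j ≥ J(lam)`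
(same inequality, same quantifier order otherwise). -/
def CoarseHandoverUpperDyadic (L0 : ℕ) [NeZero L0] : Prop :=
  ∀ k : ℕ, ∀ ε : ℝ, 0 < ε → ∃ lam0 : ℝ, 0 < lam0 ∧ ∀ lam : ℝ, 0 < lam → lam ≤ lam0 →
    ∃ J : ℕ, ∀ (j L : ℕ) [NeZero L], J ≤ j → L = L0 * 2 ^ j → ∀ β : ℝ, InFemtoWindow lam β L →
      ∀ β' : ℝ, 1 ≤ β' → luscherLambda β' L0 = luscherLambda β L →
        levelValue su2Rep L β k ^ L * levelValue su2Rep L0 β' 0 ^ L0 ≤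
          Real.exp (ε * luscherLambda β L) * (levelValue su2Rep L0 β' k ^ L0 * levelValue su2Rep L β 0 ^ L)

/-- The bookkeeping inequality of the telescoping: `1/(j+1)² + (2 − 1/j) ≤ 2 − 1/(j+1)` for `j ≥ 1`. -/
private theorem weight_step {j : ℕ} (hj : 1 ≤ j) :
    1 / ((j : ℝ) + 1) ^ 2 + (2 - 1 / (j : ℝ)) ≤ 2 - 1 / ((j : ℝ) + 1) := by
  have hj' : (1 : ℝ) ≤ j := by exact_mod_cast hj
  have hjpos : (0 : ℝ) < j := by linarith
  have h1 : 1 / ((j : ℝ) + 1) ^ 2 ≤ 1 / ((j : ℝ) * (j + 1)) :=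
    one_div_le_one_div_of_le (by positivity) (by nlinarith)
  have h2 : 1 / ((j : ℝ) * (j + 1)) = 1 / j - 1 / (j + 1) := by
    field_simp
    ring
  linarith [h1, h2]

set_option maxHeartbeats 800000 in
/-- **Telescoping (proved): `MatchedCouplingUniform → DyadicStepUpper → CoarseHandoverUpperDyadic L0`** for every coarse size `L0`.
Induction on `j ≥ 1` along `L0·2^j ↦ L0·2^{j−1} ↦ … ↦ L0` through the matched intermediate couplings (all intermediate lattices carry the SAME label
`l = λ(β, L)`, hence sit in the same window), accumulating `|C| l² Σ_{i<j} 1/(⌊log₂(L0 2^i)⌋+1)² ≤ |C| l² (2 − 1/j) ≤ 2|C| l² ≤ ε l` once `4(|C|+1)·lam ≤ ε`;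
the middle lattice's vacuum power cancels because it is `> 0`.  `J = 1`. -/
theorem coarseHandoverUpperDyadic_of_step (L0 : ℕ) [NeZero L0] (hM : MatchedCouplingUniform) (hS : DyadicStepUpper) :
    CoarseHandoverUpperDyadic L0 := by
  intro k ε hε
  obtain ⟨lamM, hlamM, HM⟩ := hM
  obtain ⟨C, lamS, hlamS, HS⟩ := hS k
  have hA : 0 < |C| + 1 := by positivity
  refine ⟨min lamS (min lamM (ε / (4 * (|C| + 1)))), lt_min hlamS (lt_min hlamM (by positivity)), ?_⟩
  intro lam hlam hle
  have hleS : lam ≤ lamS := hle.trans (min_le_left _ _)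
  have hleM : lam ≤ lamM := (hle.trans (min_le_right _ _)).trans (min_le_left _ _)
  have hleε : lam ≤ ε / (4 * (|C| + 1)) := (hle.trans (min_le_right _ _)).trans (min_le_right _ _)
  have HSl := HS lam hlam hleS
  -- the telescoped estimate with the partial sums `2 − 1/j`
  have tower : ∀ j : ℕ, 1 ≤ j → ∀ (L : ℕ) [NeZero L], L = L0 * 2 ^ j → ∀ β : ℝ, InFemtoWindow lam β L →
      ∀ β' : ℝ, 1 ≤ β' → luscherLambda β' L0 = luscherLambda β L →
        levelValue su2Rep L β k ^ L * levelValue su2Rep L0 β' 0 ^ L0 ≤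
          Real.exp (|C| * luscherLambda β L ^ 2 * (2 - 1 / (j : ℝ))) *
            (levelValue su2Rep L0 β' k ^ L0 * levelValue su2Rep L β 0 ^ L) := by
    intro j hj
    induction j, hj using Nat.le_induction with
    | base =>
      intro L _ hL β hw β' hβ'1 hmatch
      have hLM : L = 2 * L0 := by rw [hL]; ring
      have h1 := HSl L0 L hLM β β' hw hβ'1 hmatch
      refine h1.trans (mul_le_mul_of_nonneg_right ?_
        (mul_nonneg (pow_nonneg (transferValuesNonneg L0 β' k hβ'1) _) (pow_nonneg (levelValue_zero_su2Rep_pos L β).le _)))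
      apply Real.exp_le_exp.mpr
      set l : ℝ := luscherLambda β L with hl_def
      have hlog0 : (0 : ℝ) ≤ (Nat.log 2 L0 : ℝ) := Nat.cast_nonneg _
      have hw1 : (1 : ℝ) ≤ ((Nat.log 2 L0 : ℝ) + 1) ^ 2 := by nlinarith
      have hl2 : 0 ≤ |C| * l ^ 2 := by positivity
      calc C * l ^ 2 / ((Nat.log 2 L0 : ℝ) + 1) ^ 2 ≤ |C| * l ^ 2 / ((Nat.log 2 L0 : ℝ) + 1) ^ 2 := by
              gcongr; exact le_abs_self C
        _ ≤ |C| * l ^ 2 / 1 := div_le_div_of_nonneg_left hl2 one_pos hw1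
        _ = |C| * l ^ 2 * (2 - 1 / ((1 : ℕ) : ℝ)) := by norm_num
    | succ j hj ih =>
      intro L _ hL β hw β' hβ'1 hmatch
      -- the intermediate lattice `M = L0·2^j`, `L = 2M`
      set M : ℕ := L0 * 2 ^ j with hMdef
      haveI : NeZero M := NeZero.of_pos (by rw [hMdef]; exact Nat.mul_pos (NeZero.pos L0) (Nat.two_pow_pos j))
      have hLM : L = 2 * M := by rw [hL, hMdef]; ring
      have hβ1 : 1 ≤ β := hw.1
      obtain ⟨βm, hβm1, hmatchm⟩ := HM M lam hlam hleM L β hw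
      have hwm : InFemtoWindow lam βm M := by
        refine ⟨hβm1, ?_, ?_⟩
        · rw [hmatchm]; exact hw.2.1
        · rw [hmatchm]; exact hw.2.2
      have hmatch' : luscherLambda β' L0 = luscherLambda βm M := hmatch.trans hmatchm.symm
      have hstep := HSl M L hLM β βm hw hβm1 hmatchm
      have hih := ih M hMdef βm hwm β' hβ'1 hmatch'
      rw [hmatchm] at hih
      set l : ℝ := luscherLambda β L with hl_def
      set xk := levelValue su2Rep L β k with hxk_def
      set x0 := levelValue su2Rep L β 0 with hx0_def
      set zk := levelValue su2Rep M βm k with hzk_def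
      set z0 := levelValue su2Rep M βm 0 with hz0_def
      set yk := levelValue su2Rep L0 β' k with hyk_def
      set y0 := levelValue su2Rep L0 β' 0 with hy0_def
      have hx0 : 0 < x0 := levelValue_zero_su2Rep_pos L β
      have hz0 : 0 < z0 := levelValue_zero_su2Rep_pos M βm
      have hyk : 0 ≤ yk := transferValuesNonneg L0 β' k hβ'1
      have hy0 : 0 < y0 := levelValue_zero_su2Rep_pos L0 β'
      -- the weights: `⌊log₂ M⌋ ≥ j`
      have hjM : j ≤ Nat.log 2 M :=
        Nat.le_log_of_pow_le one_lt_two (by rw [hMdef]; exact Nat.le_mul_of_pos_left _ (NeZero.pos L0))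
      have hw1 : ((j : ℝ) + 1) ^ 2 ≤ ((Nat.log 2 M : ℝ) + 1) ^ 2 := by
        have : (j : ℝ) ≤ (Nat.log 2 M : ℝ) := by exact_mod_cast hjM
        gcongr
      set a : ℝ := C * l ^ 2 / ((Nat.log 2 M : ℝ) + 1) ^ 2 with ha
      set b : ℝ := |C| * l ^ 2 * (2 - 1 / (j : ℝ)) with hb
      have hab : a + b ≤ |C| * l ^ 2 * (2 - 1 / ((j + 1 : ℕ) : ℝ)) := by
        have hl2 : 0 ≤ |C| * l ^ 2 := by positivity
        have h1 : a ≤ |C| * l ^ 2 * (1 / ((j : ℝ) + 1) ^ 2) := by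
          rw [ha]
          calc C * l ^ 2 / ((Nat.log 2 M : ℝ) + 1) ^ 2 ≤ |C| * l ^ 2 / ((Nat.log 2 M : ℝ) + 1) ^ 2 := by
                  gcongr; exact le_abs_self C
            _ ≤ |C| * l ^ 2 / ((j : ℝ) + 1) ^ 2 := div_le_div_of_nonneg_left hl2 (by positivity) hw1
            _ = |C| * l ^ 2 * (1 / ((j : ℝ) + 1) ^ 2) := by ring
        have h2 := mul_le_mul_of_nonneg_left (weight_step hj) hl2
        push_cast
        calc a + b ≤ |C| * l ^ 2 * (1 / ((j : ℝ) + 1) ^ 2) + |C| * l ^ 2 * (2 - 1 / (j : ℝ)) := by rw [hb]; linarith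
          _ = |C| * l ^ 2 * (1 / ((j : ℝ) + 1) ^ 2 + (2 - 1 / (j : ℝ))) := by ring
          _ ≤ |C| * l ^ 2 * (2 - 1 / ((j : ℝ) + 1)) := h2
      -- combine the step `xk^L z0^M ≤ e^a zk^M x0^L` with the induction hypothesis `zk^M y0^L0 ≤ e^b yk^L0 z0^M`, cancel `z0^M > 0`
      have key : xk ^ L * y0 ^ L0 * z0 ^ M ≤ Real.exp (a + b) * (yk ^ L0 * x0 ^ L) * z0 ^ M := by
        calc xk ^ L * y0 ^ L0 * z0 ^ M = (xk ^ L * z0 ^ M) * y0 ^ L0 := by ring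
          _ ≤ (Real.exp a * (zk ^ M * x0 ^ L)) * y0 ^ L0 := mul_le_mul_of_nonneg_right hstep (pow_nonneg hy0.le _)
          _ = Real.exp a * x0 ^ L * (zk ^ M * y0 ^ L0) := by ring
          _ ≤ Real.exp a * x0 ^ L * (Real.exp b * (yk ^ L0 * z0 ^ M)) :=
              mul_le_mul_of_nonneg_left hih (mul_nonneg (Real.exp_pos _).le (pow_nonneg hx0.le _))
          _ = (Real.exp a * Real.exp b) * (yk ^ L0 * x0 ^ L) * z0 ^ M := by ring
          _ = Real.exp (a + b) * (yk ^ L0 * x0 ^ L) * z0 ^ M := by rw [Real.exp_add]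
      have key2 : xk ^ L * y0 ^ L0 ≤ Real.exp (a + b) * (yk ^ L0 * x0 ^ L) := le_of_mul_le_mul_right key (pow_pos hz0 M)
      exact key2.trans (mul_le_mul_of_nonneg_right (Real.exp_le_exp.mpr hab) (mul_nonneg (pow_nonneg hyk _) (pow_nonneg hx0.le _)))
  -- conclusion: `J = 1`, and `|C| l² (2 − 1/j) ≤ 2|C| l² ≤ ε l`
  refine ⟨1, ?_⟩
  intro j L _ hj hL β hw β' hβ'1 hmatch
  have h := tower j hj L hL β hw β' hβ'1 hmatch
  refine h.trans (mul_le_mul_of_nonneg_right ?_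
    (mul_nonneg (pow_nonneg (transferValuesNonneg L0 β' k hβ'1) _) (pow_nonneg (levelValue_zero_su2Rep_pos L β).le _)))
  apply Real.exp_le_exp.mpr
  set l : ℝ := luscherLambda β L with hl_def
  have hl : 0 < l := luscherLambda_pos_of_window hlam hw
  have hl2 : l ≤ 2 * lam := hw.2.2
  have hjinv : 0 ≤ 1 / (j : ℝ) := by positivity
  have hCl : |C| * l ≤ ε / 2 := by
    have h4 : lam * (4 * (|C| + 1)) ≤ ε := by
      have := hleε; rwa [le_div_iff₀ (by positivity)] at this
    have : |C| * l ≤ (|C| + 1) * (2 * lam) := by nlinarith [abs_nonneg C]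
    linarith
  calc |C| * l ^ 2 * (2 - 1 / (j : ℝ)) ≤ |C| * l ^ 2 * 2 := by
        apply mul_le_mul_of_nonneg_left _ (by positivity); linarith
    _ = 2 * l * (|C| * l) := by ring
    _ ≤ 2 * l * (ε / 2) := by gcongr
    _ = ε * l := by ring

/-- TOWER is (trivially) implied by 3a′: `CoarseHandoverUpper L0 → CoarseHandoverUpperDyadic L0` (`J = L1`, since `L0·2^j ≥ 2^j > j`). -/
theorem coarseHandoverUpperDyadic_of_upper (L0 : ℕ) [NeZero L0] (hU : CoarseHandoverUpper L0) :
    CoarseHandoverUpperDyadic L0 := by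
  intro k ε hε
  obtain ⟨lam0, hlam0, H⟩ := hU k ε hε
  refine ⟨lam0, hlam0, ?_⟩
  intro lam hlam hle
  obtain ⟨L1, HL⟩ := H lam hlam hle
  refine ⟨L1, ?_⟩
  intro j L _ hj hL β hw β' hβ'1 hmatch
  have hL1 : L1 ≤ L := by
    rw [hL]
    calc L1 ≤ j := hj
      _ ≤ 2 ^ j := Nat.lt_two_pow_self.le
      _ ≤ L0 * 2 ^ j := Nat.le_mul_of_pos_left _ (NeZero.pos L0)
  exact HL L hL1 β hw β' hβ'1 hmatch


/-! ## What TOWER gives without FILL: KT's stub 3 on the dyadic sizes (PROVED composition with 3b′) -/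

/-- **`KTCoarseNoIntruderDyadic L0`**: the text of KT's stub 3 `CoarseNoIntruder` (tree-module copy `KTCoarseNoIntruder`) restricted to the fine sizes
`L = L0·2^j`, `j ≥ J(lam)` — the DYADIC RUNG.  NEEDS-OWNER: whether this (at `L0 = 2`) may replace stub 3 as the leaf of record of an RG line. -/
def KTCoarseNoIntruderDyadic (L0 : ℕ) : Prop :=
  ∀ k : ℕ, ∀ d : ℝ, d < levelGap k → ∃ lam0 : ℝ, 0 < lam0 ∧ ∀ lam : ℝ, 0 < lam → lam ≤ lam0 →
    ∃ J : ℕ, ∀ (j L : ℕ) [NeZero L], J ≤ j → L = L0 * 2 ^ j → ∀ β : ℝ, InFemtoWindow lam β L →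
      levelValue su2Rep L β k ≤ Real.exp (-(d * luscherLambda β L) / L) * levelValue su2Rep L β 0

/-- `exp(x/n)^n = exp x` for a lattice size `n` (copy of the tree module's private lemma). -/
private theorem exp_div_natpow (x : ℝ) (n : ℕ) [NeZero n] : Real.exp (x / n) ^ n = Real.exp x := by
  have hn : (n : ℝ) ≠ 0 := Nat.cast_ne_zero.mpr (NeZero.ne n)
  rw [← Real.exp_nat_mul]; congr 1; field_simp

/-- The dyadic rung is a restriction of KT's stub 3: `KTCoarseNoIntruder → KTCoarseNoIntruderDyadic L0`. -/
theorem ktCoarseNoIntruderDyadic_of_full (L0 : ℕ) [NeZero L0] (h : KTCoarseNoIntruder) : KTCoarseNoIntruderDyadic L0 := by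
  intro k d hd
  obtain ⟨lam0, hlam0, H⟩ := h k d hd
  refine ⟨lam0, hlam0, ?_⟩
  intro lam hlam hle
  obtain ⟨L1, HL⟩ := H lam hlam hle
  refine ⟨L1, ?_⟩
  intro j L _ hj hL β hw
  have hL1 : L1 ≤ L := by
    rw [hL]
    calc L1 ≤ j := hj
      _ ≤ 2 ^ j := Nat.lt_two_pow_self.le
      _ ≤ L0 * 2 ^ j := Nat.le_mul_of_pos_left _ (NeZero.pos L0)
  exact HL L hL1 β hw

set_option maxHeartbeats 400000 in
/-- **TOWER ∧ 3b′ ⟹ the dyadic rung (proved): `CoarseHandoverUpperDyadic L0 → CoarseNoIntruderAt L0 → KTCoarseNoIntruderDyadic L0`.**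
Verbatim the tree module's `coarseNoIntruder_of_handover` (matching from `matchedCouplingUniform`), with `L` restricted to `L0·2^j`. -/
theorem ktCoarseNoIntruderDyadic_of_handover (L0 : ℕ) [NeZero L0] (hU : CoarseHandoverUpperDyadic L0)
    (hB : CoarseNoIntruderAt L0) : KTCoarseNoIntruderDyadic L0 := by
  intro k d hd
  obtain ⟨lamM, hlamM, HM⟩ := matchedCouplingUniform
  set ε : ℝ := (levelGap k - d) / 2 with hε_def
  have hε : 0 < ε := by rw [hε_def]; linarith
  set d' : ℝ := d + ε with hd'_def
  have hd' : d' < levelGap k := by rw [hd'_def, hε_def]; linarith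
  obtain ⟨lU, hlU, HU⟩ := hU k ε hε
  obtain ⟨lB, hlB, HB⟩ := hB k d' hd'
  refine ⟨min lamM (min lU lB), lt_min hlamM (lt_min hlU hlB), ?_⟩
  intro lam hlam hle
  have hleM : lam ≤ lamM := hle.trans (min_le_left _ _)
  have hleU : lam ≤ lU := (hle.trans (min_le_right _ _)).trans (min_le_left _ _)
  have hleB : lam ≤ lB := (hle.trans (min_le_right _ _)).trans (min_le_right _ _)
  obtain ⟨J, HJ⟩ := HU lam hlam hleU
  refine ⟨J, ?_⟩
  intro j L _ hj hL β hw
  have hβ1 : 1 ≤ β := hw.1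
  obtain ⟨β', hβ'1, hmatch⟩ := HM L0 lam hlam hleM L β hw
  have hw' : InFemtoWindow lam β' L0 := by
    refine ⟨hβ'1, ?_, ?_⟩
    · rw [hmatch]; exact hw.2.1
    · rw [hmatch]; exact hw.2.2
  have hU1 := HJ j L hj hL β hw β' hβ'1 hmatch
  have hB1 := HB lam hlam hleB β' hw'
  rw [hmatch] at hB1
  set l : ℝ := luscherLambda β L with hl_def
  set xk := levelValue su2Rep L β k with hxk_def
  set x0 := levelValue su2Rep L β 0 with hx0_def
  set yk := levelValue su2Rep L0 β' k with hyk_def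
  set y0 := levelValue su2Rep L0 β' 0 with hy0_def
  have hxk : 0 ≤ xk := transferValuesNonneg L β k hβ1
  have hx0 : 0 < x0 := levelValue_zero_su2Rep_pos L β
  have hyk : 0 ≤ yk := transferValuesNonneg L0 β' k hβ'1
  have hy0 : 0 < y0 := levelValue_zero_su2Rep_pos L0 β'
  have hBp : yk ^ L0 ≤ Real.exp (-(d' * l)) * y0 ^ L0 := by
    have := pow_le_pow_left₀ hyk hB1 L0
    rwa [mul_pow, exp_div_natpow] at this
  have hexp : Real.exp (ε * l) * Real.exp (-(d' * l)) = Real.exp (-(d * l)) := by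
    rw [← Real.exp_add]; congr 1; rw [hd'_def]; ring
  have key : xk ^ L * y0 ^ L0 ≤ Real.exp (-(d * l)) * x0 ^ L * y0 ^ L0 := by
    calc xk ^ L * y0 ^ L0 ≤ Real.exp (ε * l) * (yk ^ L0 * x0 ^ L) := hU1
      _ ≤ Real.exp (ε * l) * ((Real.exp (-(d' * l)) * y0 ^ L0) * x0 ^ L) :=
          mul_le_mul_of_nonneg_left (mul_le_mul_of_nonneg_right hBp (pow_nonneg hx0.le _)) (Real.exp_pos _).le
      _ = (Real.exp (ε * l) * Real.exp (-(d' * l))) * x0 ^ L * y0 ^ L0 := by ring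
      _ = Real.exp (-(d * l)) * x0 ^ L * y0 ^ L0 := by rw [hexp]
  have hpos : 0 < y0 ^ L0 := pow_pos hy0 L0
  have key2 : xk ^ L ≤ Real.exp (-(d * l)) * x0 ^ L := le_of_mul_le_mul_right key hpos
  have key3 : xk ^ L ≤ (Real.exp (-(d * l) / L) * x0) ^ L := by rwa [mul_pow, exp_div_natpow]
  exact (pow_le_pow_iff_left₀ hxk (mul_nonneg (Real.exp_pos _).le hx0.le) (NeZero.ne L)).mp key3


/-! ## FILL = incommensurable-cutoff universality, and the recomposition of 3a′ (PROVED) -/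

/-- **FILL = `IncommensurableFill L0` (XL; lever (d)'s irreducible content)**: every fine window point `(L, β)`, `L ≥ L1(lam)`, hands over — no-intruder
direction, slack `e^{ελ}` — to SOME dyadic lattice `N = L0·2^j` of comparable size (`L ≤ 2N`; the prover chooses `j`, e.g. the dyadic size nearest to `L`)
at a matched coupling `βN ≥ 1`, `λ(βN, N) = λ(β, L)`.  Two lattice theories of the same kind in the same physical volume at INCOMMENSURABLE cutoffs
`a/a' = N/L ∉ 2^ℤ`: no blocking map relates them; the comparison must go through cutoff-independent objects (lever (d): uniform-in-cutoff control of the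
low-lying spectrum in a femto box, e.g. a momentum-slice phase-cell expansion whose slicing ignores the lattice, or continuum-limit existence PLUS one-scale
visibility on both lattices).
[REV 2 CORRECTION of the previous sentence: an UNEQUAL-box block-averaging map `(ℤ/L)³ → (ℤ/N)³` (box sides `⌊L/N⌋, ⌈L/N⌉`) exists for every
`N ≤ L/2`; the coarser-partner form of this seam, `BoundedRatioFill L0` (§ MIXED-BLOCK FILL), is discharged by ONE bounded-ratio RG step — no continuum
object is needed for densification.  This decl (partner of comparable-or-FINER size, `L ≤ 2N`) is kept verbatim as rev-1 record.] -/
def IncommensurableFill (L0 : ℕ) : Prop :=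
  ∀ k : ℕ, ∀ ε : ℝ, 0 < ε → ∃ lam0 : ℝ, 0 < lam0 ∧ ∀ lam : ℝ, 0 < lam → lam ≤ lam0 →
    ∃ L1 : ℕ, ∀ (L : ℕ) [NeZero L], L1 ≤ L → ∀ β : ℝ, InFemtoWindow lam β L →
      ∃ (j : ℕ) (βN : ℝ), L ≤ 2 * (L0 * 2 ^ j) ∧ 1 ≤ βN ∧ ∀ (N : ℕ) [NeZero N], N = L0 * 2 ^ j →
        luscherLambda βN N = luscherLambda β L ∧
        levelValue su2Rep L β k ^ L * levelValue su2Rep N βN 0 ^ N ≤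
          Real.exp (ε * luscherLambda β L) * (levelValue su2Rep N βN k ^ N * levelValue su2Rep L β 0 ^ L)

set_option maxHeartbeats 400000 in
/-- **Recomposition (proved): `CoarseHandoverUpperDyadic L0 → IncommensurableFill L0 → CoarseHandoverUpper L0`** — TOWER at `ε/2` from the dyadic
lattice `N` down to `L0`, FILL at `ε/2` from `L` to `N`; `N`'s vacuum power cancels; `L ≥ 2·L0·2^J` forces `j ≥ J`. -/
theorem coarseHandoverUpper_of_dyadic_fill (L0 : ℕ) [NeZero L0] (hT : CoarseHandoverUpperDyadic L0)
    (hF : IncommensurableFill L0) : CoarseHandoverUpper L0 := by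
  intro k ε hε
  obtain ⟨lT, hlT, HT⟩ := hT k (ε / 2) (by linarith)
  obtain ⟨lF, hlF, HF⟩ := hF k (ε / 2) (by linarith)
  refine ⟨min lT lF, lt_min hlT hlF, ?_⟩
  intro lam hlam hle
  obtain ⟨J, HJ⟩ := HT lam hlam (hle.trans (min_le_left _ _))
  obtain ⟨L1, HL⟩ := HF lam hlam (hle.trans (min_le_right _ _))
  refine ⟨max L1 (2 * (L0 * 2 ^ J)), ?_⟩
  intro L _ hL β hw β' hβ'1 hmatch
  have hL1 : L1 ≤ L := (le_max_left _ _).trans hL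
  have hLJ : 2 * (L0 * 2 ^ J) ≤ L := (le_max_right _ _).trans hL
  obtain ⟨j, βN, hjL, hβN1, HN⟩ := HL L hL1 β hw
  have hj : J ≤ j := by
    have h1 : 2 * (L0 * 2 ^ J) ≤ 2 * (L0 * 2 ^ j) := hLJ.trans hjL
    have h2 : L0 * 2 ^ J ≤ L0 * 2 ^ j := Nat.le_of_mul_le_mul_left h1 two_pos
    have h3 : 2 ^ J ≤ 2 ^ j := Nat.le_of_mul_le_mul_left h2 (NeZero.pos L0)
    exact (Nat.pow_le_pow_iff_right one_lt_two).mp h3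
  haveI : NeZero (L0 * 2 ^ j) := NeZero.of_pos (Nat.mul_pos (NeZero.pos L0) (Nat.two_pow_pos j))
  obtain ⟨hmatchN, hfill⟩ := HN (L0 * 2 ^ j) rfl
  have hβ1 : 1 ≤ β := hw.1
  have hwN : InFemtoWindow lam βN (L0 * 2 ^ j) :=
    ⟨hβN1, by rw [hmatchN]; exact hw.2.1, by rw [hmatchN]; exact hw.2.2⟩
  have hmatch' : luscherLambda β' L0 = luscherLambda βN (L0 * 2 ^ j) := hmatch.trans hmatchN.symm
  have htow := HJ j (L0 * 2 ^ j) hj rfl βN hwN β' hβ'1 hmatch'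
  rw [hmatchN] at htow
  set N : ℕ := L0 * 2 ^ j with hNdef
  set l : ℝ := luscherLambda β L with hl_def
  set xk := levelValue su2Rep L β k with hxk_def
  set x0 := levelValue su2Rep L β 0 with hx0_def
  set nk := levelValue su2Rep N βN k with hnk_def
  set n0 := levelValue su2Rep N βN 0 with hn0_def
  set yk := levelValue su2Rep L0 β' k with hyk_def
  set y0 := levelValue su2Rep L0 β' 0 with hy0_def
  have hx0 : 0 < x0 := levelValue_zero_su2Rep_pos L β
  have hn0 : 0 < n0 := levelValue_zero_su2Rep_pos N βN
  have hy0 : 0 < y0 := levelValue_zero_su2Rep_pos L0 β'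
  have hyk : 0 ≤ yk := transferValuesNonneg L0 β' k hβ'1
  have hexp : Real.exp (ε / 2 * l) * Real.exp (ε / 2 * l) = Real.exp (ε * l) := by
    rw [← Real.exp_add]; congr 1; ring
  have key : xk ^ L * y0 ^ L0 * n0 ^ N ≤ Real.exp (ε * l) * (yk ^ L0 * x0 ^ L) * n0 ^ N := by
    calc xk ^ L * y0 ^ L0 * n0 ^ N = (xk ^ L * n0 ^ N) * y0 ^ L0 := by ring
      _ ≤ (Real.exp (ε / 2 * l) * (nk ^ N * x0 ^ L)) * y0 ^ L0 := mul_le_mul_of_nonneg_right hfill (pow_nonneg hy0.le _)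
      _ = Real.exp (ε / 2 * l) * x0 ^ L * (nk ^ N * y0 ^ L0) := by ring
      _ ≤ Real.exp (ε / 2 * l) * x0 ^ L * (Real.exp (ε / 2 * l) * (yk ^ L0 * n0 ^ N)) :=
          mul_le_mul_of_nonneg_left htow (mul_nonneg (Real.exp_pos _).le (pow_nonneg hx0.le _))
      _ = (Real.exp (ε / 2 * l) * Real.exp (ε / 2 * l)) * (yk ^ L0 * x0 ^ L) * n0 ^ N := by ring
      _ = Real.exp (ε * l) * (yk ^ L0 * x0 ^ L) * n0 ^ N := by rw [hexp]
  exact le_of_mul_le_mul_right key (pow_pos hn0 N)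

/-! ### Calibration of FILL: it follows from KT's stub 3 together with the LOWER femto law on the dyadic lattices (both believed true), so the split
{TOWER, FILL} of 3a′ is faithful modulo lower laws — neither piece is stronger than what the route already wants, and neither alone gives 3a′. -/

/-- **`DyadicLowerLaw L0`** (calibration only): on the dyadic sizes `N = L0·2^j`, `j ≥ J(lam)`, level `k` does not decay FASTER than Lüscher's law predicts,
`e^{−(Δ_k+ε)λ/N} λ_0 ≤ λ_k` (the lower direction of RED's conclusion composed with ONE; variational). -/
def DyadicLowerLaw (L0 : ℕ) : Prop :=
  ∀ k : ℕ, ∀ ε : ℝ, 0 < ε → ∃ lam0 : ℝ, 0 < lam0 ∧ ∀ lam : ℝ, 0 < lam → lam ≤ lam0 →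
    ∃ J : ℕ, ∀ (j N : ℕ) [NeZero N], J ≤ j → N = L0 * 2 ^ j → ∀ β : ℝ, InFemtoWindow lam β N →
      Real.exp (-((levelGap k + ε) * luscherLambda β N) / N) * levelValue su2Rep N β 0 ≤ levelValue su2Rep N β k

set_option maxHeartbeats 400000 in
/-- **Calibration (proved): `KTCoarseNoIntruder → DyadicLowerLaw L0 → IncommensurableFill L0`.**  Fine side (stub 3 at `d = Δ_k − ε/2`) to the power `L`,
dyadic lower law at `ε/2` to the power `N`, `N = L0·2^{max J L} ≥ L`, matched coupling from `matchedCouplingUniform`. -/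
theorem incommensurableFill_of_noIntruder (L0 : ℕ) [NeZero L0] (hC : KTCoarseNoIntruder) (hLow : DyadicLowerLaw L0) :
    IncommensurableFill L0 := by
  intro k ε hε
  obtain ⟨lamM, hlamM, HM⟩ := matchedCouplingUniform
  obtain ⟨lC, hlC, HC⟩ := hC k (levelGap k - ε / 2) (by linarith)
  obtain ⟨lW, hlW, HW⟩ := hLow k (ε / 2) (by linarith)
  refine ⟨min lamM (min lC lW), lt_min hlamM (lt_min hlC hlW), ?_⟩
  intro lam hlam hle
  have hleM : lam ≤ lamM := hle.trans (min_le_left _ _)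
  have hleC : lam ≤ lC := (hle.trans (min_le_right _ _)).trans (min_le_left _ _)
  have hleW : lam ≤ lW := (hle.trans (min_le_right _ _)).trans (min_le_right _ _)
  obtain ⟨L1, HL⟩ := HC lam hlam hleC
  obtain ⟨J, HJ⟩ := HW lam hlam hleW
  refine ⟨L1, ?_⟩
  intro L _ hL β hw
  have hβ1 : 1 ≤ β := hw.1
  -- the dyadic partner: `j = max J L`, `N = L0·2^j ≥ 2^L > L`
  set j : ℕ := max J L with hjdef
  have hjJ : J ≤ j := le_max_left _ _
  have hLN : L ≤ 2 * (L0 * 2 ^ j) := by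
    calc L ≤ 2 ^ L := Nat.lt_two_pow_self.le
      _ ≤ 2 ^ j := Nat.pow_le_pow_right two_pos (le_max_right _ _)
      _ ≤ L0 * 2 ^ j := Nat.le_mul_of_pos_left _ (NeZero.pos L0)
      _ ≤ 2 * (L0 * 2 ^ j) := Nat.le_mul_of_pos_left _ two_pos
  haveI hN0 : NeZero (L0 * 2 ^ j) := NeZero.of_pos (Nat.mul_pos (NeZero.pos L0) (Nat.two_pow_pos j))
  obtain ⟨βN, hβN1, hmatchN⟩ := HM (L0 * 2 ^ j) lam hlam hleM L β hw
  refine ⟨j, βN, hLN, hβN1, ?_⟩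
  intro N _ hN
  subst hN
  refine ⟨hmatchN, ?_⟩
  have hwN : InFemtoWindow lam βN (L0 * 2 ^ j) :=
    ⟨hβN1, by rw [hmatchN]; exact hw.2.1, by rw [hmatchN]; exact hw.2.2⟩
  have hC1 := HL L hL β hw
  have hW1 := HJ j (L0 * 2 ^ j) hjJ rfl βN hwN
  rw [hmatchN] at hW1
  set N : ℕ := L0 * 2 ^ j with hNdef
  set l : ℝ := luscherLambda β L with hl_def
  set xk := levelValue su2Rep L β k with hxk_def
  set x0 := levelValue su2Rep L β 0 with hx0_def
  set nk := levelValue su2Rep N βN k with hnk_def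
  set n0 := levelValue su2Rep N βN 0 with hn0_def
  have hxk : 0 ≤ xk := transferValuesNonneg L β k hβ1
  have hx0 : 0 < x0 := levelValue_zero_su2Rep_pos L β
  have hn0 : 0 < n0 := levelValue_zero_su2Rep_pos N βN
  have hCp : xk ^ L ≤ Real.exp (-((levelGap k - ε / 2) * l)) * x0 ^ L := by
    have := pow_le_pow_left₀ hxk hC1 L
    rwa [mul_pow, exp_div_natpow] at this
  have hWp : Real.exp (-((levelGap k + ε / 2) * l)) * n0 ^ N ≤ nk ^ N := by
    have := pow_le_pow_left₀ (mul_nonneg (Real.exp_pos _).le hn0.le) hW1 N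
    rwa [mul_pow, exp_div_natpow] at this
  have hexp : Real.exp (-((levelGap k - ε / 2) * l)) = Real.exp (ε * l) * Real.exp (-((levelGap k + ε / 2) * l)) := by
    rw [← Real.exp_add]; congr 1; ring
  calc xk ^ L * n0 ^ N ≤ (Real.exp (-((levelGap k - ε / 2) * l)) * x0 ^ L) * n0 ^ N :=
        mul_le_mul_of_nonneg_right hCp (pow_nonneg hn0.le _)
    _ = Real.exp (ε * l) * ((Real.exp (-((levelGap k + ε / 2) * l)) * n0 ^ N) * x0 ^ L) := by rw [hexp]; ring
    _ ≤ Real.exp (ε * l) * (nk ^ N * x0 ^ L) :=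
        mul_le_mul_of_nonneg_left (mul_le_mul_of_nonneg_right hWp (pow_nonneg hx0.le _)) (Real.exp_pos _).le

/-! ## The two compositions a crux-plan seat would register (PROVED one-liners at the canonical coarse size `L0 = 2`) -/

/-- **3a′ from STEP ∧ FILL: `DyadicStepUpper → IncommensurableFill 2 → CoarseHandoverUpper 2`** (= KTH's `stub_coarseHandoverUpper2`, ∀-`L` leaf kept). -/
theorem coarseHandoverUpper_two_of_step_fill (hS : DyadicStepUpper) (hF : IncommensurableFill 2) : CoarseHandoverUpper 2 :=
  coarseHandoverUpper_of_dyadic_fill 2 (coarseHandoverUpperDyadic_of_step 2 matchedCouplingUniform hS) hF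

/-- **The dyadic rung from STEP ∧ 3b′ alone: `DyadicStepUpper → CoarseNoIntruderAt 2 → KTCoarseNoIntruderDyadic 2`** (no FILL; dyadic leaf). -/
theorem ktCoarseNoIntruderDyadic_two_of_step (hS : DyadicStepUpper) (hB : CoarseNoIntruderAt 2) : KTCoarseNoIntruderDyadic 2 :=
  ktCoarseNoIntruderDyadic_of_handover 2 (coarseHandoverUpperDyadic_of_step 2 matchedCouplingUniform hS) hB

/-! ## § MIXED-BLOCK FILL (REV 2, g8, 2026-08-27) — the densification seam of owner ruling (r2), TYPED and LOCATED: one bounded-ratio (unequal-box) step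

Owner ruling (r2) (p1 g18, STATUS 2026-08-27T05:16:38Z): «an RG prover may prove 3a′/T2′ along `L = L0·2^j` first; the route's crux text stays `∀ L ≥ L0` and the
densification is a separate S/M seam to be typed when such a proof exists».  This section types the seam and shows where it lives.

* ARITHMETIC (`blockLen`, `sum_blockLen_range`, `le_blockLen`, `blockLen_le`, `exists_dyadic_partner`): for every `N ≤ L/2` the cycle `ℤ/L` is tiled by `N`
  consecutive intervals of lengths `⌊L/N⌋` or `⌊L/N⌋+1`; for a dyadic `N = L0·2^j ∈ [L/4, L/2]` (exists once `L ≥ 2L0`) the lengths lie in `{2,3,4}` and differ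
  by at most one.  Hence `(ℤ/L)³` is partitioned into `N³` near-cubic boxes of AT MOST 8 SHAPES (`{q,q+1}³`, aspect ratio ≤ 3/2) and a Bałaban-type block-averaging
  map `(ℤ/L)³ → (ℤ/N)³` EXISTS for every `L ≥ 2N` — correcting rev 1 («no blocking map relates incommensurable cutoffs»: true for EQUAL cubic blocks only; a
  prime `L` has no equal-block coarse-graining except the total one, but it has unequal-block ones onto every `N ≤ L/2`).
* `BoundedRatioStepUpper` = STEP (`DyadicStepUpper`) with the size ratio `L/N ∈ [2,4]` instead of `= 2`: ONE coarse-graining at matched two-loop label over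
  unequal near-cubic boxes, no-intruder direction, cross-multiplied, the same budget `exp(Cλ²/(⌊log₂N⌋+1)²)` (F17b: summable along the tower, dominating the
  three-loop label mismatch `∝ λ⁴/β_N²` and the artefacts `λ²/N²`; at the FIRST step `N ≥ L/4 → ∞` it is tiny).  Restricts to STEP: `dyadicStepUpper_of_boundedRatio`.
* `BoundedRatioFill L0` = the densification seam proper: every fine window point `(L, β)`, `L ≥ L1`, hands over (upper direction, slack `e^{ελ}`) to a COARSER
  dyadic partner `N = L0·2^j`, `2N ≤ L ≤ 4N`, at a matched coupling `βN ≥ 1`.  PROVED below: `boundedRatioFill_of_step : BoundedRatioStepUpper → BoundedRatioFill L0`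
  (every `L0`, via `matchedCouplingUniform`); the recomposition `coarseHandoverUpper_of_dyadic_bfill : CoarseHandoverUpperDyadic L0 → BoundedRatioFill L0 →
  CoarseHandoverUpper L0`; the headline `coarseHandoverUpper_of_boundedRatioStep : BoundedRatioStepUpper → CoarseHandoverUpper L0` — 3a′ FOR ALL `L` and EVERY
  coarse size from ONE one-step statement (with 3b′ `CoarseNoIntruderAt 2`, KT's stub 3 then follows by the rev-3 tree theorem
  `KTCoarseHandover.coarseNoIntruder_of_handover_two`); and the calibration `boundedRatioFill_of_noIntruder : KTCoarseNoIntruder → DyadicLowerLaw L0 →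
  BoundedRatioFill L0` (the seam is not stronger than what the route already believes).
* VERDICT on (r2).  STAND-ALONE — relating the low spectra of `(ℤ/L)³` and `(ℤ/N)³` at equal running `λ` without an RG step — the seam is a lattice-universality
  statement of 3a′'s own class (XL), not S/M: nothing soft (monotonicity in `L`, RP-convexity, β-continuity) relates transfer spectra of different spatial lattices
  to relative precision `o(λ)/L`, and linear inter-cutoff state maps are barred (card F21, NO-LINEAR-INTERCUTOFF-MAP).  INSIDE an RG line it costs NOTHING EXTRA
  provided the one-step Bałaban-class estimate is typed for boxes with sides in `{q, q+1}` (finitely many shapes ⇒ every per-box constant is a maximum; the method's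
  random-walk ∕ small-field machinery is local, not translation-invariant) rather than for cubes of side 2 only — then there is NO separate seam and NO continuum
  detour (lever (d)) in the densification.  (If instead ONE multi-scale flow is run from `L` down to `L0`, the unequal first layer persists in the COMPOSITE
  averaging constraints of the finest-lattice propagators `G_k` at every scale `k`, as boxes of aspect ratio ≤ `(q+1)/q ≤ 3/2`: the hypothesis to carry is a
  uniform aspect bound, one geometric parameter in the propagator ∕ localisation estimates — asserted «easily extended to other definitions of averaging
  operations» in [Balaban 1985, CMP 98, p. 20] but not printed; commensurable volumes `L_μ = L^m` throughout [Balaban 1987, CMP 109, p. 251], [Dimock arXiv:1712.10029, p. 1].)  RECOMMENDATION to the seat typing the first RG estimate (owner g18 ∕ the (α) seat): type it for bounded-ratio boxes.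
-/

/-! ### Arithmetic of unequal-block tilings -/

/-- Length of the `i`-th of `N` consecutive blocks tiling `ℤ/L` as evenly as possible: `⌊L/N⌋ + [i < L mod N]`. -/
def blockLen (L N i : ℕ) : ℕ := L / N + if i < L % N then 1 else 0

theorem div_le_blockLen (L N i : ℕ) : L / N ≤ blockLen L N i := Nat.le_add_right _ _

/-- The block lengths differ by at most one (`{q, q+1}`, `q = ⌊L/N⌋`). -/
theorem blockLen_le_div_succ (L N i : ℕ) : blockLen L N i ≤ L / N + 1 := by
  unfold blockLen; split_ifs <;> omega

/-- `∑_{i<n} [i < r] = min r n`. -/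
theorem sum_indicator_lt (r n : ℕ) : ∑ i ∈ Finset.range n, (if i < r then 1 else 0) = min r n := by
  induction n with
  | zero => simp
  | succ n ih =>
    rw [Finset.sum_range_succ, ih]
    by_cases h : n < r
    · rw [if_pos h]; omega
    · rw [if_neg h]; omega

/-- **The `N` blocks tile `ℤ/L`: `∑_{i<N} blockLen L N i = L`.** -/
theorem sum_blockLen_range (L : ℕ) {N : ℕ} (hN : 0 < N) : ∑ i ∈ Finset.range N, blockLen L N i = L := by
  unfold blockLen
  rw [Finset.sum_add_distrib, Finset.sum_const, Finset.card_range, smul_eq_mul, sum_indicator_lt,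
    Nat.min_eq_left (Nat.mod_lt L hN).le]
  exact Nat.div_add_mod L N

/-- Lower side bound: `s·N ≤ L ⇒ s ≤ blockLen L N i`. -/
theorem le_blockLen {L N s : ℕ} (hN : 0 < N) (h : s * N ≤ L) (i : ℕ) : s ≤ blockLen L N i :=
  ((Nat.le_div_iff_mul_le hN).mpr h).trans (div_le_blockLen L N i)

/-- Upper side bound: `L ≤ t·N ⇒ blockLen L N i ≤ t`. -/
theorem blockLen_le {L N t : ℕ} (hN : 0 < N) (h : L ≤ t * N) (i : ℕ) : blockLen L N i ≤ t := by
  unfold blockLen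
  split_ifs with hi
  · have hmod : 0 < L % N := lt_of_le_of_lt (Nat.zero_le i) hi
    have hne : L ≠ t * N := by
      intro hL; rw [hL, Nat.mul_mod_left] at hmod; exact lt_irrefl 0 hmod
    have hlt : L < t * N := lt_of_le_of_ne h hne
    exact (Nat.div_lt_iff_lt_mul hN).mpr hlt
  · have h' : L ≤ N * t := by rwa [Nat.mul_comm] at h
    simpa using Nat.div_le_of_le_mul h'

/-- In the ratio window `2N ≤ L ≤ 4N` every block side lies in `{2,3,4}` (and in `{⌊L/N⌋, ⌊L/N⌋+1}`). -/
theorem blockLen_mem_window {L N : ℕ} (hN : 0 < N) (h2 : 2 * N ≤ L) (h4 : L ≤ 4 * N) (i : ℕ) :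
    2 ≤ blockLen L N i ∧ blockLen L N i ≤ 4 :=
  ⟨le_blockLen hN h2 i, blockLen_le hN h4 i⟩

/-- **Dyadic partner in the ratio window**: for `L ≥ 2·L0` there is `j` with `2·(L0·2^j) ≤ L < 4·(L0·2^j)`. -/
theorem exists_dyadic_partner (L0 : ℕ) [NeZero L0] {L : ℕ} (hL : 2 * L0 ≤ L) :
    ∃ j : ℕ, 2 * (L0 * 2 ^ j) ≤ L ∧ L < 4 * (L0 * 2 ^ j) := by
  have h2L0 : 0 < 2 * L0 := Nat.mul_pos two_pos (NeZero.pos L0)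
  set q : ℕ := L / (2 * L0) with hq
  have hq1 : 1 ≤ q := (Nat.le_div_iff_mul_le h2L0).mpr (by simpa using hL)
  refine ⟨Nat.log 2 q, ?_, ?_⟩
  · have h1 : 2 ^ Nat.log 2 q ≤ q := Nat.pow_log_le_self 2 (by omega)
    have h2 : 2 ^ Nat.log 2 q * (2 * L0) ≤ L := (Nat.le_div_iff_mul_le h2L0).mp h1
    calc 2 * (L0 * 2 ^ Nat.log 2 q) = 2 ^ Nat.log 2 q * (2 * L0) := by ring
      _ ≤ L := h2
  · have h1 : q < 2 ^ (Nat.log 2 q + 1) := Nat.lt_pow_succ_log_self one_lt_two q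
    have h2 : L < 2 ^ (Nat.log 2 q + 1) * (2 * L0) := (Nat.div_lt_iff_lt_mul h2L0).mp h1
    calc L < 2 ^ (Nat.log 2 q + 1) * (2 * L0) := h2
      _ = 4 * (L0 * 2 ^ Nat.log 2 q) := by ring

/-- **General blocking factor** (Bałaban's native RG is `s`-adic with `s` an odd integer `> 11` [Balaban 1987, CMP 109, p. 251]; his averaging operations
allow any fixed integer `s > 1` and «sums of several cubes» [Balaban 1985, CMP 98, p. 17]): for `L ≥ s·L0` there is `j` with `s·(L0·s^j) ≤ L < s²·(L0·s^j)`,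
so the first step averages over near-equal boxes with sides `blockLen L N i ∈ [s, s²)`, `N = L0·s^j`, and the rest of the tower is `s`-adic.  (For an `s`-adic
line replace `(2^j, [2,4], log₂)` by `(s^j, [s,s²], log_s)` in STEP ∕ TOWER ∕ `BoundedRatioStepUpper` ∕ `BoundedRatioFill`; the proofs below are unchanged in form.) -/
theorem exists_sadic_partner {s : ℕ} (hs : 2 ≤ s) (L0 : ℕ) [NeZero L0] {L : ℕ} (hL : s * L0 ≤ L) :
    ∃ j : ℕ, s * (L0 * s ^ j) ≤ L ∧ L < s ^ 2 * (L0 * s ^ j) := by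
  have hs0 : 0 < s := by omega
  have hsL0 : 0 < s * L0 := Nat.mul_pos hs0 (NeZero.pos L0)
  set q : ℕ := L / (s * L0) with hq
  have hq1 : 1 ≤ q := (Nat.le_div_iff_mul_le hsL0).mpr (by simpa using hL)
  refine ⟨Nat.log s q, ?_, ?_⟩
  · have h1 : s ^ Nat.log s q ≤ q := Nat.pow_log_le_self s (by omega)
    have h2 : s ^ Nat.log s q * (s * L0) ≤ L := (Nat.le_div_iff_mul_le hsL0).mp h1
    calc s * (L0 * s ^ Nat.log s q) = s ^ Nat.log s q * (s * L0) := by ring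
      _ ≤ L := h2
  · have h1 : q < s ^ (Nat.log s q + 1) := Nat.lt_pow_succ_log_self (by omega) q
    have h2 : L < s ^ (Nat.log s q + 1) * (s * L0) := (Nat.div_lt_iff_lt_mul hsL0).mp h1
    calc L < s ^ (Nat.log s q + 1) * (s * L0) := h2
      _ = s ^ 2 * (L0 * s ^ Nat.log s q) := by ring

/-- In the `s`-adic ratio window `sN ≤ L ≤ s²N` every block side lies in `[s, s²]`. -/
theorem blockLen_mem_window_base {s L N : ℕ} (hN : 0 < N) (hlo : s * N ≤ L) (hhi : L ≤ s ^ 2 * N) (i : ℕ) :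
    s ≤ blockLen L N i ∧ blockLen L N i ≤ s ^ 2 :=
  ⟨le_blockLen hN hlo i, blockLen_le hN hhi i⟩

/-- A partner found below a threshold `4·(L0·2^J) ≤ L` sits at height `j ≥ J` of the tower. -/
theorem dyadic_partner_ge {L0 J j L : ℕ} [NeZero L0] (hJ : 4 * (L0 * 2 ^ J) ≤ L) (hj : L < 4 * (L0 * 2 ^ j)) : J ≤ j := by
  have h1 : 4 * (L0 * 2 ^ J) < 4 * (L0 * 2 ^ j) := lt_of_le_of_lt hJ hj
  have h2 : L0 * 2 ^ J < L0 * 2 ^ j := Nat.lt_of_mul_lt_mul_left h1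
  have h3 : 2 ^ J < 2 ^ j := Nat.lt_of_mul_lt_mul_left h2
  exact ((Nat.pow_lt_pow_iff_right one_lt_two).mp h3).le

/-! ### The one-step statement over unequal boxes and the densification seam -/

/-- **`BoundedRatioStepUpper` (XL)**: STEP over UNEQUAL near-cubic boxes — ONE coarse-graining `(ℤ/L)³ → (ℤ/N)³` for ANY sizes with `2N ≤ L ≤ 4N` (boxes with
sides `blockLen L N i ∈ {⌊L/N⌋, ⌊L/N⌋+1} ⊂ {2,3,4}`) at matched two-loop label `λ(β', N) = λ(β, L)`, no-intruder direction, cross-multiplied, budget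
`exp(Cλ²/(⌊log₂N⌋+1)²)`.  `DyadicStepUpper` is its restriction to `L = 2N`.  Proof obligations = STEP's (F19: one-step effective action in correlation form,
one-scale visibility of the fine low states, two-loop matching, artefacts), with every per-box constant a maximum over the ≤ 8 box shapes. -/
def BoundedRatioStepUpper : Prop :=
  ∀ k : ℕ, ∃ C lam0 : ℝ, 0 < lam0 ∧ ∀ lam : ℝ, 0 < lam → lam ≤ lam0 →
    ∀ (L N : ℕ) [NeZero L] [NeZero N], 2 * N ≤ L → L ≤ 4 * N → ∀ β β' : ℝ, InFemtoWindow lam β L → 1 ≤ β' →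
      luscherLambda β' N = luscherLambda β L →
        levelValue su2Rep L β k ^ L * levelValue su2Rep N β' 0 ^ N ≤
          Real.exp (C * luscherLambda β L ^ 2 / ((Nat.log 2 N : ℝ) + 1) ^ 2) *
            (levelValue su2Rep N β' k ^ N * levelValue su2Rep L β 0 ^ L)

/-- STEP is the equal-block case of the bounded-ratio step: `BoundedRatioStepUpper → DyadicStepUpper`. -/
theorem dyadicStepUpper_of_boundedRatio (h : BoundedRatioStepUpper) : DyadicStepUpper := by
  intro k
  obtain ⟨C, lam0, hlam0, H⟩ := h k
  refine ⟨C, lam0, hlam0, ?_⟩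
  intro lam hlam hle M N _ _ hNM β β' hw hβ' hmatch
  have h2 : 2 * M ≤ N := by omega
  have h4 : N ≤ 4 * M := by omega
  exact H lam hlam hle N M h2 h4 β β' hw hβ' hmatch

/-- **`BoundedRatioFill L0` — the densification seam of ruling (r2), typed**: every fine window point `(L, β)`, `L ≥ L1(lam)`, hands over — no-intruder direction,
slack `e^{ελ}` — to a COARSER DYADIC partner `N = L0·2^j` with `2N ≤ L ≤ 4N` at a matched coupling `βN ≥ 1`, `λ(βN, N) = λ(β, L)`.  Together with the dyadic
TOWER it gives 3a′ for all `L` (`coarseHandoverUpper_of_dyadic_bfill`); it is discharged by ONE bounded-ratio RG step (`boundedRatioFill_of_step`).  Compare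
rev 1's `IncommensurableFill L0` (partner of comparable-or-finer size `L ≤ 2N`, the continuum-detour reading): different side condition, same role. -/
def BoundedRatioFill (L0 : ℕ) : Prop :=
  ∀ k : ℕ, ∀ ε : ℝ, 0 < ε → ∃ lam0 : ℝ, 0 < lam0 ∧ ∀ lam : ℝ, 0 < lam → lam ≤ lam0 →
    ∃ L1 : ℕ, ∀ (L : ℕ) [NeZero L], L1 ≤ L → ∀ β : ℝ, InFemtoWindow lam β L →
      ∃ (j : ℕ) (βN : ℝ), 2 * (L0 * 2 ^ j) ≤ L ∧ L ≤ 4 * (L0 * 2 ^ j) ∧ 1 ≤ βN ∧ ∀ (N : ℕ) [NeZero N], N = L0 * 2 ^ j →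
        luscherLambda βN N = luscherLambda β L ∧
        levelValue su2Rep L β k ^ L * levelValue su2Rep N βN 0 ^ N ≤
          Real.exp (ε * luscherLambda β L) * (levelValue su2Rep N βN k ^ N * levelValue su2Rep L β 0 ^ L)

/-- Budget bookkeeping: if `2·lam·(|C|+1) ≤ ε`-ish (precisely `lam ≤ ε/(2(|C|+1))`), `0 < l ≤ 2·lam` and `D ≥ 1`, then `C·l²/D ≤ ε·l`. -/
theorem step_budget_le {C ε lam l D : ℝ} (hε : 0 < ε) (hlamE : lam ≤ ε / (2 * (|C| + 1))) (hl0 : 0 < l) (hl2 : l ≤ 2 * lam)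
    (hD : 1 ≤ D) : C * l ^ 2 / D ≤ ε * l := by
  have hc : 0 < |C| + 1 := by positivity
  have hDpos : 0 < D := lt_of_lt_of_le one_pos hD
  have e1 : ε / (2 * (|C| + 1)) * 2 = ε / (|C| + 1) := by
    field_simp
  have h2 : 2 * lam ≤ ε / (|C| + 1) := by linarith [hlamE, e1]
  have h3 : |C| * (ε / (|C| + 1)) ≤ ε := by
    have hq : |C| / (|C| + 1) ≤ 1 := (div_le_one hc).mpr (by linarith)
    calc |C| * (ε / (|C| + 1)) = ε * (|C| / (|C| + 1)) := by ring
      _ ≤ ε * 1 := mul_le_mul_of_nonneg_left hq hε.le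
      _ = ε := mul_one ε
  have hCl : |C| * l ≤ ε :=
    calc |C| * l ≤ |C| * (2 * lam) := mul_le_mul_of_nonneg_left hl2 (abs_nonneg C)
      _ ≤ |C| * (ε / (|C| + 1)) := mul_le_mul_of_nonneg_left h2 (abs_nonneg C)
      _ ≤ ε := h3
  calc C * l ^ 2 / D ≤ |C| * l ^ 2 / D :=
        div_le_div_of_nonneg_right (mul_le_mul_of_nonneg_right (le_abs_self C) (sq_nonneg l)) hDpos.le
    _ ≤ |C| * l ^ 2 := div_le_self (by positivity) hD
    _ = (|C| * l) * l := by ring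
    _ ≤ ε * l := mul_le_mul_of_nonneg_right hCl hl0.le

set_option maxHeartbeats 400000 in
/-- **The seam from one bounded-ratio step (proved): `BoundedRatioStepUpper → BoundedRatioFill L0`** for every coarse size `L0` — partner `N = L0·2^j ∈ [L/4, L/2]`
from `exists_dyadic_partner`, matched coupling from `matchedCouplingUniform`, budget `Cλ²/(⌊log₂N⌋+1)² ≤ |C|λ·2lam ≤ ελ` once `lam ≤ ε/(2(|C|+1))`. -/
theorem boundedRatioFill_of_step (L0 : ℕ) [NeZero L0] (hS : BoundedRatioStepUpper) : BoundedRatioFill L0 := by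
  intro k ε hε
  obtain ⟨lamM, hlamM, HM⟩ := matchedCouplingUniform
  obtain ⟨C, lS, hlS, HS⟩ := hS k
  refine ⟨min lamM (min lS (ε / (2 * (|C| + 1)))), lt_min hlamM (lt_min hlS (by positivity)), ?_⟩
  intro lam hlam hle
  have hleM : lam ≤ lamM := hle.trans (min_le_left _ _)
  have hleS : lam ≤ lS := (hle.trans (min_le_right _ _)).trans (min_le_left _ _)
  have hleE : lam ≤ ε / (2 * (|C| + 1)) := (hle.trans (min_le_right _ _)).trans (min_le_right _ _)
  refine ⟨2 * L0, ?_⟩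
  intro L _ hL β hw
  obtain ⟨j, hjlo, hjhi⟩ := exists_dyadic_partner L0 hL
  haveI hN0 : NeZero (L0 * 2 ^ j) := NeZero.of_pos (Nat.mul_pos (NeZero.pos L0) (Nat.two_pow_pos j))
  obtain ⟨βN, hβN1, hmatchN⟩ := HM (L0 * 2 ^ j) lam hlam hleM L β hw
  refine ⟨j, βN, hjlo, hjhi.le, hβN1, ?_⟩
  intro N _ hN
  subst hN
  refine ⟨hmatchN, ?_⟩
  have hstep := HS lam hlam hleS L (L0 * 2 ^ j) hjlo hjhi.le β βN hw hβN1 hmatchN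
  set N : ℕ := L0 * 2 ^ j with hNdef
  set l : ℝ := luscherLambda β L with hl_def
  have hl0 : 0 < l := lt_of_lt_of_le hlam hw.2.1
  have hl2 : l ≤ 2 * lam := hw.2.2
  have hD : (1 : ℝ) ≤ ((Nat.log 2 N : ℝ) + 1) ^ 2 := by
    have h0 : (0 : ℝ) ≤ (Nat.log 2 N : ℝ) := Nat.cast_nonneg _
    nlinarith
  have hbud : C * l ^ 2 / ((Nat.log 2 N : ℝ) + 1) ^ 2 ≤ ε * l := step_budget_le hε hleE hl0 hl2 hD
  have hnn : 0 ≤ levelValue su2Rep N βN k ^ N * levelValue su2Rep L β 0 ^ L :=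
    mul_nonneg (pow_nonneg (transferValuesNonneg N βN k hβN1) _) (pow_nonneg (levelValue_zero_su2Rep_pos L β).le _)
  exact hstep.trans (mul_le_mul_of_nonneg_right (Real.exp_le_exp.mpr hbud) hnn)

set_option maxHeartbeats 400000 in
/-- **Recomposition (proved): `CoarseHandoverUpperDyadic L0 → BoundedRatioFill L0 → CoarseHandoverUpper L0`** — TOWER at `ε/2` from the dyadic partner `N`
down to `L0`, the seam at `ε/2` from `L` to `N`; `N`'s vacuum power cancels; `L ≥ 4·L0·2^J` forces `j ≥ J`.  (Rev 1's `coarseHandoverUpper_of_dyadic_fill`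
with the coarser-partner side condition.) -/
theorem coarseHandoverUpper_of_dyadic_bfill (L0 : ℕ) [NeZero L0] (hT : CoarseHandoverUpperDyadic L0)
    (hF : BoundedRatioFill L0) : CoarseHandoverUpper L0 := by
  intro k ε hε
  obtain ⟨lT, hlT, HT⟩ := hT k (ε / 2) (by linarith)
  obtain ⟨lF, hlF, HF⟩ := hF k (ε / 2) (by linarith)
  refine ⟨min lT lF, lt_min hlT hlF, ?_⟩
  intro lam hlam hle
  obtain ⟨J, HJ⟩ := HT lam hlam (hle.trans (min_le_left _ _))
  obtain ⟨L1, HL⟩ := HF lam hlam (hle.trans (min_le_right _ _))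
  refine ⟨max L1 (4 * (L0 * 2 ^ J)), ?_⟩
  intro L _ hL β hw β' hβ'1 hmatch
  have hL1 : L1 ≤ L := (le_max_left _ _).trans hL
  have hLJ : 4 * (L0 * 2 ^ J) ≤ L := (le_max_right _ _).trans hL
  obtain ⟨j, βN, _hjlo, hjhi, hβN1, HN⟩ := HL L hL1 β hw
  have hj : J ≤ j := by
    have h1 : 4 * (L0 * 2 ^ J) ≤ 4 * (L0 * 2 ^ j) := hLJ.trans hjhi
    have h2 : L0 * 2 ^ J ≤ L0 * 2 ^ j := Nat.le_of_mul_le_mul_left h1 (by norm_num)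
    have h3 : 2 ^ J ≤ 2 ^ j := Nat.le_of_mul_le_mul_left h2 (NeZero.pos L0)
    exact (Nat.pow_le_pow_iff_right one_lt_two).mp h3
  haveI : NeZero (L0 * 2 ^ j) := NeZero.of_pos (Nat.mul_pos (NeZero.pos L0) (Nat.two_pow_pos j))
  obtain ⟨hmatchN, hfill⟩ := HN (L0 * 2 ^ j) rfl
  have hβ1 : 1 ≤ β := hw.1
  have hwN : InFemtoWindow lam βN (L0 * 2 ^ j) :=
    ⟨hβN1, by rw [hmatchN]; exact hw.2.1, by rw [hmatchN]; exact hw.2.2⟩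
  have hmatch' : luscherLambda β' L0 = luscherLambda βN (L0 * 2 ^ j) := hmatch.trans hmatchN.symm
  have htow := HJ j (L0 * 2 ^ j) hj rfl βN hwN β' hβ'1 hmatch'
  rw [hmatchN] at htow
  set N : ℕ := L0 * 2 ^ j with hNdef
  set l : ℝ := luscherLambda β L with hl_def
  set xk := levelValue su2Rep L β k with hxk_def
  set x0 := levelValue su2Rep L β 0 with hx0_def
  set nk := levelValue su2Rep N βN k with hnk_def
  set n0 := levelValue su2Rep N βN 0 with hn0_def
  set yk := levelValue su2Rep L0 β' k with hyk_def
  set y0 := levelValue su2Rep L0 β' 0 with hy0_def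
  have hx0 : 0 < x0 := levelValue_zero_su2Rep_pos L β
  have hn0 : 0 < n0 := levelValue_zero_su2Rep_pos N βN
  have hy0 : 0 < y0 := levelValue_zero_su2Rep_pos L0 β'
  have hyk : 0 ≤ yk := transferValuesNonneg L0 β' k hβ'1
  have hexp : Real.exp (ε / 2 * l) * Real.exp (ε / 2 * l) = Real.exp (ε * l) := by
    rw [← Real.exp_add]; congr 1; ring
  have key : xk ^ L * y0 ^ L0 * n0 ^ N ≤ Real.exp (ε * l) * (yk ^ L0 * x0 ^ L) * n0 ^ N := by
    calc xk ^ L * y0 ^ L0 * n0 ^ N = (xk ^ L * n0 ^ N) * y0 ^ L0 := by ring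
      _ ≤ (Real.exp (ε / 2 * l) * (nk ^ N * x0 ^ L)) * y0 ^ L0 := mul_le_mul_of_nonneg_right hfill (pow_nonneg hy0.le _)
      _ = Real.exp (ε / 2 * l) * x0 ^ L * (nk ^ N * y0 ^ L0) := by ring
      _ ≤ Real.exp (ε / 2 * l) * x0 ^ L * (Real.exp (ε / 2 * l) * (yk ^ L0 * n0 ^ N)) :=
          mul_le_mul_of_nonneg_left htow (mul_nonneg (Real.exp_pos _).le (pow_nonneg hx0.le _))
      _ = (Real.exp (ε / 2 * l) * Real.exp (ε / 2 * l)) * (yk ^ L0 * x0 ^ L) * n0 ^ N := by ring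
      _ = Real.exp (ε * l) * (yk ^ L0 * x0 ^ L) * n0 ^ N := by rw [hexp]
  exact le_of_mul_le_mul_right key (pow_pos hn0 N)

/-- **HEADLINE (proved): `BoundedRatioStepUpper → CoarseHandoverUpper L0` for EVERY coarse size `L0`** — 3a′ for ALL fine sizes `L` from ONE one-step statement
over unequal near-cubic boxes: the first step lands on the dyadic tower (`boundedRatioFill_of_step`), the tower telescopes (`coarseHandoverUpperDyadic_of_step` ∘
`dyadicStepUpper_of_boundedRatio`), and the two recompose (`coarseHandoverUpper_of_dyadic_bfill`).  No separate densification seam, no continuum detour. -/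
theorem coarseHandoverUpper_of_boundedRatioStep (L0 : ℕ) [NeZero L0] (hS : BoundedRatioStepUpper) : CoarseHandoverUpper L0 :=
  coarseHandoverUpper_of_dyadic_bfill L0
    (coarseHandoverUpperDyadic_of_step L0 matchedCouplingUniform (dyadicStepUpper_of_boundedRatio hS))
    (boundedRatioFill_of_step L0 hS)

/-- At the canonical coarse size: **`BoundedRatioStepUpper → CoarseHandoverUpper 2`** (= KTR's registered 3a′ `stub_coarseHandoverUpper2`, all `L`). -/
theorem coarseHandoverUpper_two_of_boundedRatioStep (hS : BoundedRatioStepUpper) : CoarseHandoverUpper 2 :=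
  coarseHandoverUpper_of_boundedRatioStep 2 hS

set_option maxHeartbeats 400000 in
/-- **Calibration (proved): `KTCoarseNoIntruder → DyadicLowerLaw L0 → BoundedRatioFill L0`** — fine side (stub 3 at `d = Δ_k − ε/2`) to the power `L`, dyadic
lower law at `ε/2` to the power `N` on the coarser partner `N = L0·2^j ∈ [L/4, L/2]` (`j ≥ J` forced by `L ≥ 4·L0·2^J`), matched coupling from
`matchedCouplingUniform`: the seam is implied by what the route already believes (it is not a hidden strengthening). -/
theorem boundedRatioFill_of_noIntruder (L0 : ℕ) [NeZero L0] (hC : KTCoarseNoIntruder) (hLow : DyadicLowerLaw L0) :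
    BoundedRatioFill L0 := by
  intro k ε hε
  obtain ⟨lamM, hlamM, HM⟩ := matchedCouplingUniform
  obtain ⟨lC, hlC, HC⟩ := hC k (levelGap k - ε / 2) (by linarith)
  obtain ⟨lW, hlW, HW⟩ := hLow k (ε / 2) (by linarith)
  refine ⟨min lamM (min lC lW), lt_min hlamM (lt_min hlC hlW), ?_⟩
  intro lam hlam hle
  have hleM : lam ≤ lamM := hle.trans (min_le_left _ _)
  have hleC : lam ≤ lC := (hle.trans (min_le_right _ _)).trans (min_le_left _ _)
  have hleW : lam ≤ lW := (hle.trans (min_le_right _ _)).trans (min_le_right _ _)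
  obtain ⟨L1, HL⟩ := HC lam hlam hleC
  obtain ⟨J, HJ⟩ := HW lam hlam hleW
  refine ⟨max L1 (4 * (L0 * 2 ^ J)), ?_⟩
  intro L _ hL β hw
  have hβ1 : 1 ≤ β := hw.1
  have hL1 : L1 ≤ L := (le_max_left _ _).trans hL
  have hLJ : 4 * (L0 * 2 ^ J) ≤ L := (le_max_right _ _).trans hL
  have h2L0 : 2 * L0 ≤ L := by
    calc 2 * L0 ≤ 4 * (L0 * 2 ^ J) := by
          have : L0 ≤ L0 * 2 ^ J := Nat.le_mul_of_pos_right _ (Nat.two_pow_pos J)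
          omega
      _ ≤ L := hLJ
  obtain ⟨j, hjlo, hjhi⟩ := exists_dyadic_partner L0 h2L0
  have hjJ : J ≤ j := dyadic_partner_ge hLJ hjhi
  haveI hN0 : NeZero (L0 * 2 ^ j) := NeZero.of_pos (Nat.mul_pos (NeZero.pos L0) (Nat.two_pow_pos j))
  obtain ⟨βN, hβN1, hmatchN⟩ := HM (L0 * 2 ^ j) lam hlam hleM L β hw
  refine ⟨j, βN, hjlo, hjhi.le, hβN1, ?_⟩
  intro N _ hN
  subst hN
  refine ⟨hmatchN, ?_⟩
  have hwN : InFemtoWindow lam βN (L0 * 2 ^ j) :=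
    ⟨hβN1, by rw [hmatchN]; exact hw.2.1, by rw [hmatchN]; exact hw.2.2⟩
  have hC1 := HL L hL1 β hw
  have hW1 := HJ j (L0 * 2 ^ j) hjJ rfl βN hwN
  rw [hmatchN] at hW1
  set N : ℕ := L0 * 2 ^ j with hNdef
  set l : ℝ := luscherLambda β L with hl_def
  set xk := levelValue su2Rep L β k with hxk_def
  set x0 := levelValue su2Rep L β 0 with hx0_def
  set nk := levelValue su2Rep N βN k with hnk_def
  set n0 := levelValue su2Rep N βN 0 with hn0_def
  have hxk : 0 ≤ xk := transferValuesNonneg L β k hβ1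
  have hx0 : 0 < x0 := levelValue_zero_su2Rep_pos L β
  have hn0 : 0 < n0 := levelValue_zero_su2Rep_pos N βN
  have hCp : xk ^ L ≤ Real.exp (-((levelGap k - ε / 2) * l)) * x0 ^ L := by
    have := pow_le_pow_left₀ hxk hC1 L
    rwa [mul_pow, exp_div_natpow] at this
  have hWp : Real.exp (-((levelGap k + ε / 2) * l)) * n0 ^ N ≤ nk ^ N := by
    have := pow_le_pow_left₀ (mul_nonneg (Real.exp_pos _).le hn0.le) hW1 N
    rwa [mul_pow, exp_div_natpow] at this
  have hexp : Real.exp (-((levelGap k - ε / 2) * l)) = Real.exp (ε * l) * Real.exp (-((levelGap k + ε / 2) * l)) := by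
    rw [← Real.exp_add]; congr 1; ring
  calc xk ^ L * n0 ^ N ≤ (Real.exp (-((levelGap k - ε / 2) * l)) * x0 ^ L) * n0 ^ N :=
        mul_le_mul_of_nonneg_right hCp (pow_nonneg hn0.le _)
    _ = Real.exp (ε * l) * ((Real.exp (-((levelGap k + ε / 2) * l)) * n0 ^ N) * x0 ^ L) := by rw [hexp]; ring
    _ ≤ Real.exp (ε * l) * (nk ^ N * x0 ^ L) :=
        mul_le_mul_of_nonneg_left (mul_le_mul_of_nonneg_right hWp (pow_nonneg hx0.le _)) (Real.exp_pos _).le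

end Summit.QuantumFields.YangMills.Cruxes.RunningReduction.KTHandoverTower
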